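import Summits.AtomisticToContinuum.BoseEinsteinCondensation.Theorems.BECCutLineWeakDisorderTwoReplicaTransienceBoundPerBox
import Summits.AtomisticToContinuum.BoseEinsteinCondensation.Theorems.BECCutLineWeakDisorderWitnessTransferEnvelope
import Summits.AtomisticToContinuum.BoseEinsteinCondensation.Theorems.BECCutLineWeakDisorderGroundStateRigidityStubFiniteEnergyLowDensity
import HarnessLib

/-!
# Crux `TwoReplicaTransienceBound` (stmt-AtomisticToContinuum-9687): the PER-BOX bound for EVERY
# admissible pair potential (hard cores included) — the crux with `∃ C` and `∀ᶠ n` interchanged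

Support file (does not close the item) for the crux
`Summit.AtomisticToContinuum.BoseEinsteinCondensation.Theses.BECCutLineWeakDisorder.TwoReplicaTransienceBound`
(route `BECCutLineWeakDisorder`, line `SketchIdeator1`, lead c2). The crux reads

  `∀ v admissible, ∃ ρ₀ > 0, ∀ ρ ∈ (0, ρ₀), ∃ C, ∀ᶠ n, ∀ T ≥ 1, ∫ L³ m_T²/s_T² dY ≤ C`.

This file proves the statement with the two quantifiers `∃ C` and `∀ᶠ n` INTERCHANGED
(`twoReplicaTransienceBound_perBox_admissible`, registered toolbox stub `stub_perBoxAdmissible`):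

  `∀ v admissible, ∃ ρ₀ > 0, ∀ ρ ∈ (0, ρ₀), ∀ᶠ n, ∃ C, ∀ T ≥ 1, ∫ L³ m_T²/s_T² dY ≤ C`,

for EVERY repulsive finite-range `v` — hard cores and hollow shells included. Ingredients, all in the tree:
the per-box bound given non-vacuity `‖e^{-2H}1‖₂² ≠ 0` (`PerBox.lintegral_ratio_fkWitness_one_le`:
`L² → L^∞` smoothing at time one + the log-convexity ladder, no ground state); the lower envelope
`‖e^{-TH_N}1‖₂² ≥ c e^{-2E₀T} > 0` whenever the variational ground-state energy `E₀` is finite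
(`CutLineWitness.stub_envelope`, truncations of `v` and their Feynman–Kac ground states); and finiteness
of `E₀(n+1, L_{n+1})` for all large `n` at low density (`GroundStateRigidity.stub_finiteEnergyLowDensity`,
Ruelle's subcritical bound: hard cores fit). So, in full generality, the ENTIRE content of the crux is the
uniformity of the constant in the particle number; the low-density threshold `ρ₀(v)` enters here only to
make the boxes non-vacuous.

## References

* B. Simon, *Schrödinger semigroups*, Bull. AMS 7 (1982), §A1 (A7). [Simon1982]
* D. Ruelle, *Statistical Mechanics: Rigorous Results* (1969), §3.5.11. [Ruelle1969]
-/

noncomputable section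

open MeasureTheory Filter Set
open scoped ENNReal NNReal Topology

namespace Summit.AtomisticToContinuum.BoseEinsteinCondensation.Cruxes.TwoReplicaTransienceBound.PerBox

open Literature.MathematicalPhysics.QuantumManyBody.BoseGas
open Summit.AtomisticToContinuum.BoseEinsteinCondensation.Theorems.CutLineWitness

/-- **Non-vacuity of the box at finite energy**: for measurable `v`, `L > 0`, `N ≥ 1` and finite
variational ground-state energy, `‖e^{-TH_N}1‖₂² ≠ 0` for every `T ≥ 0` (the lower envelope
`stub_envelope`). [cite: Simon1982, §A1 (A7) p. 449] -/
theorem fkNormSq_one_ne_zero_of_energy_ne_top {N : ℕ} {v : ℝ → ℝ≥0∞} (hv : Measurable v) {L : ℝ}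
    (hL : 0 < L) (hN : 1 ≤ N) (hE : groundStateEnergy v N L ≠ ⊤) {T : ℝ} (hT : 0 ≤ T) :
    fkNormSq (N := N) v L T (fun _ => (1 : ℝ≥0∞)) ≠ 0 := by
  obtain ⟨c, hc, hle⟩ := stub_envelope hv hL hN hE
  have hpos : 0 < ENNReal.ofReal (c * Real.exp (-(2 * (groundStateEnergy v N L).toReal * T))) :=
    ENNReal.ofReal_pos.2 (mul_pos hc (Real.exp_pos _))
  exact (hpos.trans_le (hle T hT)).ne'

/-- **The crux with `∃ C` and `∀ᶠ n` interchanged holds for EVERY admissible pair potential**: for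
every repulsive finite-range `v` (hard cores allowed) there is `ρ₀ > 0` such that for `0 < ρ < ρ₀`,
for all large `n` there is `C = C(v, ρ, n)` with `∫ L³ m_T(Y)²/s_T(Y)² dY ≤ C` for ALL `T ≥ 1`
(`Ψ_T = fkWitness v L T 1`, `L = sideLength ρ (n+1)`): finite ground-state energy at low density
(`stub_finiteEnergyLowDensity`) ⇒ non-vacuous box (`fkNormSq_one_ne_zero_of_energy_ne_top`) ⇒ the
per-box bound (`lintegral_ratio_fkWitness_one_le`). [cite: Ruelle1969, §3.5.11] -/
theorem twoReplicaTransienceBound_perBox_admissible (v : ℝ → ℝ≥0∞) (hv : IsRepulsiveFiniteRange v) :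
    ∃ ρ₀ : ℝ, 0 < ρ₀ ∧ ∀ ρ : ℝ, 0 < ρ → ρ < ρ₀ → ∀ᶠ n : ℕ in Filter.atTop, ∃ C : ℝ, 0 < C ∧
      ∀ T : ℝ, 1 ≤ T →
        ∫⁻ Y : Config n, ENNReal.ofReal (sideLength ρ (n + 1) ^ 3) *
            (∫⁻ x, (‖fkWitness (N := n + 1) v (sideLength ρ (n + 1)) T (fun _ => (1 : ℝ≥0∞))
              (Matrix.vecCons x Y)‖₊ : ℝ≥0∞) ^ 2) ^ 2 /
            (∫⁻ x, (‖fkWitness (N := n + 1) v (sideLength ρ (n + 1)) T (fun _ => (1 : ℝ≥0∞))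
              (Matrix.vecCons x Y)‖₊ : ℝ≥0∞)) ^ 2 ≤ ENNReal.ofReal C := by
  obtain ⟨ρ₁, hρ₁, H⟩ :=
    Summit.AtomisticToContinuum.BoseEinsteinCondensation.Theorems.GroundStateRigidity.stub_finiteEnergyLowDensity
      v hv
  refine ⟨ρ₁, hρ₁, fun ρ hρ hρlt => ?_⟩
  have hev : ∀ᶠ n : ℕ in Filter.atTop, groundStateEnergy v (n + 1) (sideLength ρ (n + 1)) ≠ ⊤ := by
    obtain ⟨N₀, hN₀⟩ := Filter.eventually_atTop.1 (H ρ hρ hρlt)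
    exact Filter.eventually_atTop.2 ⟨N₀, fun n hn => hN₀ (n + 1) (by omega)⟩
  filter_upwards [hev] with n hn
  have hL : 0 < sideLength ρ (n + 1) :=
    Real.rpow_pos_of_pos (div_pos (by exact_mod_cast Nat.succ_pos n) hρ) _
  exact lintegral_ratio_fkWitness_one_le hv.1 _
    (fkNormSq_one_ne_zero_of_energy_ne_top hv.1 hL (Nat.le_add_left 1 n) hn zero_le_two)

end Summit.AtomisticToContinuum.BoseEinsteinCondensation.Cruxes.TwoReplicaTransienceBound.PerBox

namespace Summit.AtomisticToContinuum.BoseEinsteinCondensation.Cruxes.TwoReplicaTransienceBound.TracerDecoupling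

open Literature.MathematicalPhysics.QuantumManyBody.BoseGas

/-- **Registered toolbox stub `stub_perBoxAdmissible`** (crux stmt-AtomisticToContinuum-9687, line
`SketchIdeator1`): the crux `TwoReplicaTransienceBound` with its quantifiers `∃ C` and `∀ᶠ n`
interchanged, for EVERY admissible pair potential (`= PerBox.twoReplicaTransienceBound_perBox_admissible`). -/
theorem stub_perBoxAdmissible :
    ∀ (v : ℝ → ENNReal), IsRepulsiveFiniteRange v → ∃ ρ₀ : ℝ, 0 < ρ₀ ∧ ∀ (ρ : ℝ), 0 < ρ → ρ < ρ₀ →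
      ∀ᶠ n : ℕ in Filter.atTop, ∃ C : ℝ, 0 < C ∧ ∀ T : ℝ, 1 ≤ T →
        ∫⁻ Y : Config n, ENNReal.ofReal (sideLength ρ (n + 1) ^ 3) *
            (∫⁻ x, (‖@fkWitness (n + 1) v (sideLength ρ (n + 1)) T (fun _ => (1 : ENNReal))
              (Matrix.vecCons x Y)‖₊ : ENNReal) ^ 2) ^ 2 /
            (∫⁻ x, (‖@fkWitness (n + 1) v (sideLength ρ (n + 1)) T (fun _ => (1 : ENNReal))
              (Matrix.vecCons x Y)‖₊ : ENNReal)) ^ 2 ≤ ENNReal.ofReal C :=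
  PerBox.twoReplicaTransienceBound_perBox_admissible

end Summit.AtomisticToContinuum.BoseEinsteinCondensation.Cruxes.TwoReplicaTransienceBound.TracerDecoupling

end
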